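import Mathlib
import Literature.Analysis.ODE.RegularSingularAnalyticBranchSolution
import Summits.AtomisticToContinuum.HydrodynamicLimit.Theorems.ImplosionDichotomyDenseExcursionSonicSmoothBranchCkSeries

/-!
# Matrix and power-series tools for the analytic Frobenius pair at the sonic point
# (crux `DenseExcursion`, line `sonic-cavity-renewal`, brick for stub `stub_cavityResolventCk`, theorem T2)

Helper file (`--supports stmt-AtomisticToContinuum-12586`, line lead a2, stub-worker W4 for `stub_cavityResolventCk`).
Tools for instantiating `Literature.Analysis.ODE.IsFrobeniusData` on `E = ℂ × ℂ` uniformly in the spectral parameter: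
the `2 × 2` matrices `[[a, b],[c, d]]` as continuous linear maps (action, operator norm `≤ ‖a‖+‖b‖+‖c‖+‖d‖`, scalar
multiples, entrywise `HasSum`), the QUANTIFIED NON-RESONANCE `n ≤ (1 + ν_M/μ)‖n − s‖` for `|Im s| ≥ μ`, `‖s‖ ≤ ν_M`
(so `‖(n − s)⁻¹‖ ≤ (1 + ν_M/μ)/n`, the shape `‖Rₙ‖ ≤ c/n` of the Frobenius theorem with `c` independent of `s`), and the
SCALAR POWER-SERIES PACKAGE (registered helper `scalar_series_package`): `x ↦ Σ xⁿ • cₙ`, `‖cₙ‖ ≤ Bλⁿ`, is `C^∞` in the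
real variable on `|x| < 1/(2^{L+1}λ)` with `C^L` bounds `C(λ, L)·B` and value `c₀` at `0`. Sources: folklore.
-/

noncomputable section

open Set Filter
open scoped Topology ContDiff NNReal

namespace Summit.AtomisticToContinuum.HydrodynamicLimit.Theorems.SonicCavityRenewal

open Literature.Analysis.ODE

/-- The `2 × 2` complex matrix `[[a, b],[c, d]]` acting on `ℂ × ℂ`, as a continuous linear map. -/
local notation "𝐌[" a ", " b ", " c ", " d "]" =>
  ((a : ℂ) • ContinuousLinearMap.comp (ContinuousLinearMap.inl ℂ ℂ ℂ) (ContinuousLinearMap.fst ℂ ℂ ℂ) +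
    (b : ℂ) • ContinuousLinearMap.comp (ContinuousLinearMap.inl ℂ ℂ ℂ) (ContinuousLinearMap.snd ℂ ℂ ℂ) +
    (c : ℂ) • ContinuousLinearMap.comp (ContinuousLinearMap.inr ℂ ℂ ℂ) (ContinuousLinearMap.fst ℂ ℂ ℂ) +
    (d : ℂ) • ContinuousLinearMap.comp (ContinuousLinearMap.inr ℂ ℂ ℂ) (ContinuousLinearMap.snd ℂ ℂ ℂ))

/-- Action of `[[a, b],[c, d]]`. [folklore] -/
theorem sbMat_apply (a b c d : ℂ) (u : ℂ × ℂ) : (𝐌[a, b, c, d]) u = (a * u.1 + b * u.2, c * u.1 + d * u.2) := by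
  ext <;> simp

/-- Operator norm of `[[a, b],[c, d]]` (sup norm on `ℂ²`): at most `‖a‖ + ‖b‖ + ‖c‖ + ‖d‖`. [folklore] -/
theorem norm_sbMat_le (a b c d : ℂ) : ‖𝐌[a, b, c, d]‖ ≤ ‖a‖ + ‖b‖ + ‖c‖ + ‖d‖ := by
  refine ContinuousLinearMap.opNorm_le_bound _ (by positivity) fun u => ?_
  rw [sbMat_apply, Prod.norm_mk]
  have h1 : ‖u.1‖ ≤ ‖u‖ := norm_fst_le u
  have h2 : ‖u.2‖ ≤ ‖u‖ := norm_snd_le u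
  have ha := norm_nonneg a; have hb := norm_nonneg b; have hc := norm_nonneg c; have hd := norm_nonneg d
  refine max_le ?_ ?_
  · calc ‖a * u.1 + b * u.2‖ ≤ ‖a‖ * ‖u.1‖ + ‖b‖ * ‖u.2‖ := (norm_add_le _ _).trans (by rw [norm_mul, norm_mul])
      _ ≤ ‖a‖ * ‖u‖ + ‖b‖ * ‖u‖ := by gcongr
      _ ≤ (‖a‖ + ‖b‖ + ‖c‖ + ‖d‖) * ‖u‖ := by nlinarith [norm_nonneg u]
  · calc ‖c * u.1 + d * u.2‖ ≤ ‖c‖ * ‖u.1‖ + ‖d‖ * ‖u.2‖ := (norm_add_le _ _).trans (by rw [norm_mul, norm_mul])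
      _ ≤ ‖c‖ * ‖u‖ + ‖d‖ * ‖u‖ := by gcongr
      _ ≤ (‖a‖ + ‖b‖ + ‖c‖ + ‖d‖) * ‖u‖ := by nlinarith [norm_nonneg u]

/-- Scalar multiples of `[[a, b],[c, d]]`. [folklore] -/
theorem smul_sbMat (t a b c d : ℂ) : t • (𝐌[a, b, c, d]) = 𝐌[t * a, t * b, t * c, t * d] := by
  simp only [smul_add, smul_smul]

/-- Entrywise sums give matrix sums. [folklore] -/
theorem hasSum_sbMat {α β γ δ : ℕ → ℂ} {a b c d : ℂ} (ha : HasSum α a) (hb : HasSum β b) (hc : HasSum γ c)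
    (hd : HasSum δ d) : HasSum (fun n => 𝐌[α n, β n, γ n, δ n]) (𝐌[a, b, c, d]) :=
  (((ha.smul_const _).add (hb.smul_const _)).add (hc.smul_const _)).add (hd.smul_const _)

/-- Right inverse of `n − [[ν, β₀],[0, 0]]`: `[[1/(n−ν), β₀/(n(n−ν))],[0, 1/n]]`. [folklore] -/
theorem sbMat_rightInverse_phi {ν β₀ n : ℂ} (hne : n - ν ≠ 0) (hn0 : n ≠ 0) (w : ℂ × ℂ) :
    n • (𝐌[(n - ν)⁻¹, β₀ * ((n - ν)⁻¹ * n⁻¹), 0, n⁻¹]) w -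
      (𝐌[ν, β₀, 0, 0]) ((𝐌[(n - ν)⁻¹, β₀ * ((n - ν)⁻¹ * n⁻¹), 0, n⁻¹]) w) = w := by
  simp only [sbMat_apply, Prod.smul_mk, smul_eq_mul, Prod.mk_sub_mk]
  ext
  · field_simp; ring
  · field_simp; ring

/-- Right inverse of `n − [[0, β₀],[0, −ν]]`: `[[1/n, β₀/(n(n+ν))],[0, 1/(n+ν)]]`. [folklore] -/
theorem sbMat_rightInverse_psi {ν β₀ n : ℂ} (hne : n + ν ≠ 0) (hn0 : n ≠ 0) (w : ℂ × ℂ) :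
    n • (𝐌[n⁻¹, β₀ * ((n + ν)⁻¹ * n⁻¹), 0, (n + ν)⁻¹]) w -
      (𝐌[0, β₀, 0, -ν]) ((𝐌[n⁻¹, β₀ * ((n + ν)⁻¹ * n⁻¹), 0, (n + ν)⁻¹]) w) = w := by
  simp only [sbMat_apply, Prod.smul_mk, smul_eq_mul, Prod.mk_sub_mk]
  ext
  · field_simp; ring
  · field_simp; ring

/-- The order-`0` compatibility of the two branches: `[[ν, β₀],[0, 0]](−β₀/ν, 1) = 0 = [[0, β₀],[0, −ν]](1, 0)`.
[folklore] -/
theorem sbMat_compat {ν β₀ : ℂ} (hν : ν ≠ 0) :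
    (𝐌[ν, β₀, 0, 0]) (-(β₀ * ν⁻¹), (1 : ℂ)) = 0 ∧ (𝐌[0, β₀, 0, -ν]) ((1 : ℂ), (0 : ℂ)) = 0 := by
  simp only [sbMat_apply, Prod.mk_eq_zero]
  refine ⟨⟨?_, by ring⟩, by ring, by ring⟩
  field_simp; ring

/-- QUANTIFIED NON-RESONANCE: if `|Im s| ≥ μ > 0` and `‖s‖ ≤ ν_M` then `n ≤ (1 + ν_M/μ)‖n − s‖` for every `n : ℕ`. [folklore] -/
theorem smoothBranch_natCast_le_mul_norm_sub {s : ℂ} {μ νM : ℝ} (hμ : 0 < μ) (hμs : μ ≤ |s.im|) (hsM : ‖s‖ ≤ νM) (n : ℕ) :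
    (n : ℝ) ≤ (1 + νM / μ) * ‖(n : ℂ) - s‖ := by
  have h1 : (n : ℝ) - νM ≤ ‖(n : ℂ) - s‖ := by
    have := norm_sub_norm_le (n : ℂ) s; rw [Complex.norm_natCast] at this; linarith
  have h2 : μ ≤ ‖(n : ℂ) - s‖ := by
    have := Complex.abs_im_le_norm ((n : ℂ) - s); simp at this; exact hμs.trans this
  have hνM : 0 ≤ νM := (norm_nonneg s).trans hsM
  calc (n : ℝ) = ((n : ℝ) - νM) + νM := by ring
    _ ≤ ‖(n : ℂ) - s‖ + νM / μ * μ := by rw [div_mul_cancel₀ _ hμ.ne']; linarith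
    _ ≤ ‖(n : ℂ) - s‖ + νM / μ * ‖(n : ℂ) - s‖ := by gcongr
    _ = (1 + νM / μ) * ‖(n : ℂ) - s‖ := by ring

/-- The resolvent bound `‖1/(n − s)‖ ≤ (1 + ν_M/μ)/n` for `n ≥ 1`. [folklore] -/
theorem smoothBranch_norm_inv_sub_le {s : ℂ} {μ νM : ℝ} (hμ : 0 < μ) (hμs : μ ≤ |s.im|) (hsM : ‖s‖ ≤ νM) {n : ℕ} (hn : 1 ≤ n) :
    (n : ℂ) - s ≠ 0 ∧ ‖((n : ℂ) - s)⁻¹‖ ≤ (1 + νM / μ) / n := by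
  have h2 : μ ≤ ‖(n : ℂ) - s‖ := by
    have := Complex.abs_im_le_norm ((n : ℂ) - s); simp at this; exact hμs.trans this
  have hne : (n : ℂ) - s ≠ 0 := fun h => by rw [h, norm_zero] at h2; linarith
  refine ⟨hne, ?_⟩
  rw [norm_inv, inv_eq_one_div, div_le_div_iff₀ (norm_pos_iff.2 hne) (by exact_mod_cast hn), one_mul]
  exact smoothBranch_natCast_le_mul_norm_sub hμ hμs hsM n

/-- **Registered helper `scalar_series_package`: A SCALAR POWER SERIES OF A REAL VARIABLE** `x ↦ Σ xⁿ • cₙ`,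
`‖cₙ‖ ≤ B λⁿ`: smooth on `|x| < 1/(2^{L+1}λ)` with `C^L` bounds `C(λ, L)·B` there (the constant depending on `(λ, L)`
only), value `c₀` at `0`. [folklore] -/
theorem scalar_series_package : ∀ (lam : ℝ) (L : ℕ), 0 < lam → ∃ C : ℝ, 0 ≤ C ∧ ∀ (c : ℕ → ℂ) (B : ℝ), (∀ n, ‖c n‖ ≤ B * lam ^ n) → ContDiffOn ℝ ∞ (fun x : ℝ => ∑' n, (x : ℂ) ^ n • c n) (Set.Ioo (-(1 / (2 ^ (L + 1) * lam))) (1 / (2 ^ (L + 1) * lam))) ∧ (∑' n, ((0 : ℝ) : ℂ) ^ n • c n) = c 0 ∧ ∀ i : ℕ, i ≤ L → ∀ x ∈ Set.Ioo (-(1 / (2 ^ (L + 1) * lam))) (1 / (2 ^ (L + 1) * lam)), ‖iteratedDeriv i (fun y : ℝ => ∑' n, (y : ℂ) ^ n • c n) x‖ ≤ C * B := by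
  intro lam L hlam
  choose C hC0 hC using fun l => norm_tsum_pow_smul_family_le (F := ℂ) lam hlam l
  refine ⟨2 * ∑ l ∈ Finset.range (L + 1), C l, mul_nonneg zero_le_two (Finset.sum_nonneg fun l _ => hC0 l),
    fun c B hc => ⟨?_, by simpa using tsum_pow_smul_zero (𝕜 := ℂ) c, ?_⟩⟩
  · -- smoothness from analyticity of the complex series
    have hr : ((Real.toNNReal lam⁻¹ : ℝ≥0) : ℝ) = lam⁻¹ := Real.coe_toNNReal _ (le_of_lt (inv_pos.2 hlam))
    have h := hasFPowerSeriesOnBall_tsum_pow_smul (𝕜 := ℂ) hc hlam.le (r := Real.toNNReal lam⁻¹)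
      (Real.toNNReal_pos.2 (inv_pos.2 hlam)) (by rw [hr, mul_inv_cancel₀ hlam.ne'])
    intro x hx
    have hx' : |x| < lam⁻¹ := by
      refine (abs_lt.2 hx).trans_le ?_
      rw [one_div, inv_le_inv₀ (by positivity) hlam]
      have : (1 : ℝ) ≤ 2 ^ (L + 1) := one_le_pow₀ (by norm_num)
      nlinarith
    have hmem : (x : ℂ) ∈ Metric.eball (0 : ℂ) (Real.toNNReal lam⁻¹) := by
      rw [Metric.eball_coe, Metric.mem_ball, dist_zero_right, Complex.norm_real, Real.norm_eq_abs, hr]; exact hx'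
    have hA := (h.analyticAt_of_mem hmem).contDiffAt (n := ∞)
    exact ((hA.restrict_scalars ℝ).comp x Complex.ofRealCLM.contDiff.contDiffAt).contDiffWithinAt
  · intro i hi x hx
    have hB : 0 ≤ B := by simpa using (norm_nonneg _).trans (hc 0)
    have hx' : |x| < 1 / (2 ^ L * lam) := by
      refine (abs_lt.2 hx).trans_le (div_le_div_of_nonneg_left zero_le_one (by positivity : (0 : ℝ) < 2 ^ L * lam) ?_)
      rw [pow_succ]; nlinarith [pow_pos (two_pos : (0 : ℝ) < 2) L]
    rw [iteratedDeriv_tsum_pow_smul hc hlam L i hi x hx']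
    calc _ ≤ 2 * C i * B := hC i c B hc L hi x (abs_lt.2 hx)
      _ ≤ 2 * (∑ l ∈ Finset.range (L + 1), C l) * B := by
          gcongr; exact Finset.single_le_sum (fun l _ => hC0 l) (Finset.mem_range.2 (Nat.lt_succ_of_le hi))
      _ = _ := by ring

end Summit.AtomisticToContinuum.HydrodynamicLimit.Theorems.SonicCavityRenewal

end
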